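import Literature.RepresentationTheory.FiniteGroups.SymmetricGroupSquareEvaluation
import HarnessLib

/-!
# Det-side class sum for `λ = (15,4,2,2,2,2,2,2,2)`, `(n, m) = (3, 3)`, `d = 11` — kernel chunks 41/41 (classes 9030–10142)

Cell `pub-gct` (bundle papers/PneNP/gct-obstructions). HONEST FRAMING of that cell: rung-1
multiplicity-obstruction search for permanent versus determinant at small `(n, m)`; no claim about
VP ≠ VNP or P ≠ NP is made here or there. This file is cell DATA: partial sums of the tree's verified
Murnaghan–Nakayama evaluator
`MNEval.skSumT 33 λᵗ (11, 11, 11)` (`λᵗ = (9, 9, 2, 2, 1, 1, 1, 1, 1, 1, 1, 1, 1, 1, 1)`; semantics `2·33!·sk(λ, 3×11) = skSumT 33 λᵗ (11^3)`,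
`Literature/NumberTheory/DiophantineGeometry/DetOrbitSymKroneckerBoundEval.lean`, BLMW 2011 §5.2
(5.2.5)) over consecutive index ranges of the class list `MNEval.cycleTypes 33` of `𝔖_33`
(`p(33) = 10143` classes; this file: classes `9030, …, 10142` in 1 ranges), each range ONE
`decide +kernel` (standard axioms, no `native_decide`; ranges sized ≤ 30 000 DP work-units ≈ 15 s of kernel
time each, files ≤ 150 s). The values were PREDICTED by the cell's engine A (frozen v0.3 `0f12f6ab926b`,
`enga.symchar` characters; reference script pub-gct-engA/sklean/skterms.py, the exact order of `cycleTypes`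
replicated) and are here CHECKED by the kernel. The ranges of all chunk files are summed in
`DetSideSkElevenFifteenFour.lean` (`skSumT 33 λᵗ (11^3) = 17366635237623772991036388802560000000` = `2·33!·1`, i.e. `sk(λ, 3×11) = 1`, the det-side
number of this row of the cell's table — there a hypothesis of the tree's conditional certificate theorems,
after these files a kernel theorem). [folklore] bookkeeping; sources [BLMW2011] §5.2 Prop. 5.2.1,
[FultonHarrisGTM129] §2.1 / Ex. 4.51 (symmetric-square character formula), [BurgisserIkenmeyer2013] §5.
-/

namespace Summit.PneNP.GCT

open Literature.RepresentationTheory.FiniteGroups.MNEval (skTerm cycleTypes)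

namespace DetSideSkElevenFifteenFour

/-- Kernel class sum of `skTerm 33 λᵗ (11^3)` over classes `9030, …, 10142` of `cycleTypes 33`
(`1113` classes, 22005 work-units; value predicted by engine A, checked by the kernel). [folklore] -/
theorem c_9030_1113 :
    ((((cycleTypes 33).drop 9030).take 1113).map (skTerm 33 [9, 9, 2, 2, 1, 1, 1, 1, 1, 1, 1, 1, 1, 1, 1] [11, 11, 11])).sum =
      0 := by
  set_option maxRecDepth 100000 in
  set_option maxHeartbeats 0 in decide +kernel

end DetSideSkElevenFifteenFour

end Summit.PneNP.GCT
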